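import Summits.Ventures.PercRepro.S1CoreStarPlane

/-!
# PercRepro — the typed clauses of the 4-circuit cap Q*(ν) (p1, gen 21; `proofs/P1-S4-PERPOINT.md` §9.2)

* `ncard_subsets_eq_choose` — the `k`-subsets of a finite set `K` number `C(|K|, k)`;
* **`ncard_fourCircuitsThrough_in_six_plane_le_six`** — a 6-point plane `P ∋ e` of the e-free core carries at most 6
  four-circuits through `e` (cap(5) ≤ 6): the circuits inject into the 3-subsets of `P ∖ {e}` (10 of them); the rank-2
  triple through `e` (`S1CoreSixPlane`) kills the 3 containing its other two points, and the rank-2 triple through a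
  third point `c` kills ≥ 1 more;
The cost model's rank / nullity bound is the companion module `S1CoreCostModel`.
Axioms: standard.
-/

open scoped Matroid

namespace PercRepro

namespace S1

open Set

variable {α : Type}

/-- The `k`-subsets of a finite set `K` number `C(|K|, k)`. -/
theorem ncard_subsets_eq_choose (K : Set α) (hK : K.Finite) (k : ℕ) :
    {S : Set α | S ⊆ K ∧ S.ncard = k}.ncard = K.ncard.choose k := by
  classical
  have himg : {S : Set α | S ⊆ K ∧ S.ncard = k} =
      (fun s : Finset α => (s : Set α)) '' ((hK.toFinset.powersetCard k : Finset (Finset α)) : Set (Finset α)) := by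
    ext S
    simp only [mem_setOf_eq, mem_image, Finset.mem_coe, Finset.mem_powersetCard]
    constructor
    · rintro ⟨hSK, hSk⟩
      have hSfin : S.Finite := hK.subset hSK
      refine ⟨hSfin.toFinset, ⟨?_, ?_⟩, hSfin.coe_toFinset⟩
      · exact (Set.Finite.toFinset_subset_toFinset).2 hSK
      · rw [← ncard_eq_toFinset_card S hSfin]; exact hSk
    · rintro ⟨s, ⟨hsK, hsk⟩, rfl⟩
      refine ⟨?_, ?_⟩
      · intro a ha
        exact hK.mem_toFinset.1 (hsK (Finset.mem_coe.1 ha))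
      · rw [ncard_coe_finset]; exact hsk
  rw [himg, ncard_image_of_injective _ Finset.coe_injective, ncard_coe_finset, Finset.card_powersetCard,
    ncard_eq_toFinset_card K hK]

/-- A rank-2 triple inside a 4-circuit: impossible (a dependent proper subset). -/
theorem not_fourCircuit_of_triple_subset (M : Matroid α) {C T : Set α} (hC : M.IsCircuit C) (h4 : C.ncard = 4)
    (hT : T ⊆ C) (hT3 : T.ncard = 3) (hrT : M.eRk T ≤ 2) : False := by
  have hTss : T ⊂ C := by
    refine ⟨hT, fun hCT => ?_⟩
    have := ncard_le_ncard hCT (finite_of_ncard_pos (by omega))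
    omega
  have hind := hC.ssubset_indep hTss
  have hrk : M.eRk T = 3 := by
    rw [hind.eRk_eq_encard, ← Set.Finite.cast_ncard_eq (finite_of_ncard_pos (by omega)), hT3]; rfl
  rw [hrk] at hrT
  exact absurd hrT (by decide)

/-- **cap(5) ≤ 6**: a 6-point plane `P ∋ e` of the e-free core carries at most 6 four-circuits through `e`. -/
theorem ncard_fourCircuitsThrough_in_six_plane_le_six (M : Matroid α) [M.Finite]
    (hfree : ∀ e ∈ M.E, ∃ A ⊆ M.E \ {e}, e ∉ M.closure A ∧ e ∉ M.closure ((M.E \ {e}) \ A))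
    {P : Set α} (hP : P ⊆ M.E) (hrP : M.eRk P ≤ 3) (h6 : P.ncard = 6) {e : α} (he : e ∈ P) :
    {C : Set α | M.IsCircuit C ∧ C.ncard = 4 ∧ e ∈ C ∧ C ⊆ P}.ncard ≤ 6 := by
  classical
  set Q := P \ {e} with hQ
  have hPfin : P.Finite := M.ground_finite.subset hP
  have hQfin : Q.Finite := hPfin.subset sdiff_subset
  have hQ5 : Q.ncard = 5 := by
    have := ncard_sdiff_singleton_add_one he hPfin
    rw [← hQ] at this; omega
  have hLS2 : ∀ X ⊆ M.E, M.eRk X ≤ 2 → X.ncard ≤ 3 := by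
    intro X hX h
    have := ThmN.ncard_add_one_le_two_pow_of_eRk_le M (ThmN.not_isLoop_of_free M hfree) hfree 2 X hX h
    omega
  set 𝒞 := {C : Set α | M.IsCircuit C ∧ C.ncard = 4 ∧ e ∈ C ∧ C ⊆ P} with h𝒞
  set 𝒯 := {S : Set α | S ⊆ Q ∧ S.ncard = 3} with h𝒯
  have h𝒯fin : 𝒯.Finite := hQfin.finite_subsets.subset (fun S hS => hS.1)
  have h𝒯10 : 𝒯.ncard = 10 := by
    rw [h𝒯, ncard_subsets_eq_choose Q hQfin 3, hQ5]; rfl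
  -- the injection `C ↦ C ∖ {e}`
  have hmap : ∀ C ∈ 𝒞, C \ {e} ∈ 𝒯 := by
    intro C hC
    obtain ⟨hCc, hC4, heC, hCP⟩ := hC
    refine ⟨fun t ht => ⟨hCP ht.1, ht.2⟩, ?_⟩
    have := ncard_sdiff_singleton_add_one heC (M.ground_finite.subset hCc.subset_ground)
    omega
  have hinj : InjOn (fun C : Set α => C \ {e}) 𝒞 := by
    intro C hC C' hC' hCC'
    simp only at hCC'
    have h1 : C = insert e (C \ {e}) := (insert_sdiff_singleton.trans (insert_eq_of_mem hC.2.2.1)).symm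
    have h2 : C' = insert e (C' \ {e}) := (insert_sdiff_singleton.trans (insert_eq_of_mem hC'.2.2.1)).symm
    rw [h1, h2, hCC']
  -- the rank-2 triple through `e`: `{e, a, b}` with `a, b ∈ Q`
  obtain ⟨a, haP, b, hbP, hab, hae, hbe, hrab⟩ := exists_triple_through_of_ncard_six M hfree hP hrP h6 he
  have haQ : a ∈ Q := ⟨haP, hae⟩
  have hbQ : b ∈ Q := ⟨hbP, hbe⟩
  -- a third point `c ∈ Q ∖ {a, b}`
  have hQab : 1 ≤ (Q \ {a, b}).ncard := by
    have hsub : ({a, b} : Set α) ⊆ Q := by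
      intro t ht; simp only [mem_insert_iff, mem_singleton_iff] at ht; rcases ht with rfl | rfl; exact haQ; exact hbQ
    have := ncard_sdiff_add_ncard_of_subset hsub hQfin
    rw [ncard_pair hab] at this; omega
  obtain ⟨c, hcQ, hcab⟩ := nonempty_of_ncard_ne_zero (by omega : (Q \ {a, b}).ncard ≠ 0)
  have hca : c ≠ a := fun h => hcab (by rw [h]; simp)
  have hcb : c ≠ b := fun h => hcab (by rw [h]; simp)
  have hce : c ≠ e := hcQ.2
  -- the rank-2 triple through `c`: `{c, x, y}`
  obtain ⟨x, hxP, y, hyP, hxy, hxc, hyc, hrcxy⟩ := exists_triple_through_of_ncard_six M hfree hP hrP h6 hcQ.1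
  -- KILLED 3-subsets: `A := {S ∈ 𝒯 | a ∈ S ∧ b ∈ S}` (3 of them) and one more, `B`, disjoint from `A`
  set A := {S : Set α | S ⊆ Q ∧ S.ncard = 3 ∧ a ∈ S ∧ b ∈ S} with hA
  have hA𝒯 : A ⊆ 𝒯 := fun S hS => ⟨hS.1, hS.2.1⟩
  have hA3 : A.ncard = 3 := by
    have hAeq : A = (fun t => ({a, b, t} : Set α)) '' (Q \ {a, b}) := by
      ext S
      simp only [hA, mem_setOf_eq, mem_image, mem_sdiff, mem_insert_iff, mem_singleton_iff, not_or]
      constructor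
      · rintro ⟨hSQ, hS3, haS, hbS⟩
        obtain ⟨p, q, r, hpq, hpr, hqr, hSeq⟩ := ncard_eq_three.1 hS3
        -- the third point of `S`
        have hmem : ∀ t, t ∈ S ↔ t = p ∨ t = q ∨ t = r := by
          intro t; rw [hSeq]; simp
        have hsub : ({a, b} : Set α) ⊆ S := by
          intro t ht; simp only [mem_insert_iff, mem_singleton_iff] at ht; rcases ht with rfl | rfl; exact haS; exact hbS
        have hrest : (S \ {a, b}).ncard = 1 := by
          have := ncard_sdiff_add_ncard_of_subset hsub (hQfin.subset hSQ)
          rw [ncard_pair hab] at this; omega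
        obtain ⟨t, ht⟩ := ncard_eq_one.1 hrest
        have htS : t ∈ S \ {a, b} := by rw [ht]; simp
        refine ⟨t, ⟨hSQ htS.1, ?_, ?_⟩, ?_⟩
        · intro h; exact htS.2 (by rw [h]; simp)
        · intro h; exact htS.2 (by rw [h]; simp)
        · apply Subset.antisymm
          · intro u hu
            simp only [mem_insert_iff, mem_singleton_iff] at hu
            rcases hu with rfl | rfl | rfl
            · exact haS
            · exact hbS
            · exact htS.1
          · intro u hu
            by_cases hua : u = a
            · simp [hua]
            by_cases hub : u = b
            · simp [hub]
            have : u ∈ S \ {a, b} := ⟨hu, by simp [hua, hub]⟩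
            rw [ht] at this
            simp only [mem_singleton_iff] at this
            simp [this]
      · rintro ⟨t, ⟨htQ, hta, htb⟩, rfl⟩
        refine ⟨?_, ?_, by simp, by simp⟩
        · intro u hu
          simp only [mem_insert_iff, mem_singleton_iff] at hu
          rcases hu with rfl | rfl | rfl
          · exact haQ
          · exact hbQ
          · exact htQ
        · exact ncard_eq_three.2 ⟨a, b, t, hab, fun h => hta h.symm, fun h => htb h.symm, rfl⟩
    rw [hAeq, InjOn.ncard_image]
    · have hsub : ({a, b} : Set α) ⊆ Q := by
        intro t ht; simp only [mem_insert_iff, mem_singleton_iff] at ht; rcases ht with rfl | rfl; exact haQ; exact hbQ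
      have := ncard_sdiff_add_ncard_of_subset hsub hQfin
      rw [ncard_pair hab] at this; omega
    · intro t ht t' ht' htt'
      simp only at htt'
      have : t ∈ ({a, b, t'} : Set α) := htt' ▸ (by simp)
      simp only [mem_insert_iff, mem_singleton_iff] at this
      rcases this with h | h | h
      · exact absurd h (fun h => ht.2 (by rw [h]; simp))
      · exact absurd h (fun h => ht.2 (by rw [h]; simp))
      · exact h
  -- no circuit maps into `A`
  have hnotA : ∀ C ∈ 𝒞, C \ {e} ∉ A := by
    intro C hC hCA
    refine not_fourCircuit_of_triple_subset M hC.1 hC.2.1 (T := {e, a, b}) ?_ ?_ hrab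
    · intro t ht; simp only [mem_insert_iff, mem_singleton_iff] at ht
      rcases ht with rfl | rfl | rfl
      · exact hC.2.2.1
      · exact hCA.2.2.1.1
      · exact hCA.2.2.2.1
    · exact ncard_eq_three.2 ⟨e, a, b, hae.symm, hbe.symm, hab, rfl⟩
  -- the extra killed subset(s) from `{c, x, y}`
  -- Case 1: `e ∈ {x, y}` — a second rank-2 triple through `e`; Case 2: `{c, x, y} ⊆ Q` is itself a killed 3-subset.
  have hkill : ∃ B : Set (Set α), B ⊆ 𝒯 ∧ Disjoint A B ∧ 1 ≤ B.ncard ∧ ∀ C ∈ 𝒞, C \ {e} ∉ B := by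
    by_cases hex : e = x ∨ e = y
    · -- a second rank-2 triple through `e`: `{e, c, z}` with `z ∈ Q`, `z ≠ c`
      obtain ⟨z, hzQ, hzc, hrcz⟩ : ∃ z ∈ Q, z ≠ c ∧ M.eRk {e, c, z} ≤ 2 := by
        rcases hex with rfl | rfl
        · refine ⟨y, ⟨hyP, hxy.symm⟩, hyc, ?_⟩
          have : ({e, c, y} : Set α) = {c, e, y} := by ext t; simp only [mem_insert_iff, mem_singleton_iff]; tauto
          rw [this]; exact hrcxy
        · refine ⟨x, ⟨hxP, hxy⟩, hxc, ?_⟩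
          have : ({e, c, x} : Set α) = {c, x, e} := by ext t; simp only [mem_insert_iff, mem_singleton_iff]; tauto
          rw [this]; exact hrcxy
      -- `z ∉ {a, b}`: two distinct rank-2 triples share ≤ 1 point
      have hzab : z ≠ a ∧ z ≠ b := by
        have hT1 : ({e, a, b} : Set α) ⊆ M.E := by
          intro t ht; simp only [mem_insert_iff, mem_singleton_iff] at ht
          rcases ht with rfl | rfl | rfl; exact hP he; exact hP haP; exact hP hbP
        have hT2 : ({e, c, z} : Set α) ⊆ M.E := by
          intro t ht; simp only [mem_insert_iff, mem_singleton_iff] at ht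
          rcases ht with rfl | rfl | rfl; exact hP he; exact hP hcQ.1; exact hP hzQ.1
        have h3a : ({e, a, b} : Set α).ncard = 3 := ncard_eq_three.2 ⟨e, a, b, hae.symm, hbe.symm, hab, rfl⟩
        have hze : z ≠ e := fun h => hzQ.2 (mem_singleton_iff.2 h)
        have h3c : ({e, c, z} : Set α).ncard = 3 := ncard_eq_three.2 ⟨e, c, z, hce.symm, hze.symm, hzc.symm, rfl⟩
        have hne : ({e, a, b} : Set α) ≠ {e, c, z} := by
          intro h
          have : c ∈ ({e, a, b} : Set α) := h ▸ (by simp)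
          simp only [mem_insert_iff, mem_singleton_iff] at this
          rcases this with h' | h' | h'
          · exact hce h'
          · exact hca h'
          · exact hcb h'
        have hint := inter_ncard_le_one_of_triples M hfree hT1 hT2 hrab hrcz h3a h3c hne
        constructor
        · intro hza
          have : ({e, a} : Set α) ⊆ {e, a, b} ∩ {e, c, z} := by
            intro t ht; simp only [mem_insert_iff, mem_singleton_iff] at ht ⊢
            rcases ht with rfl | rfl
            · exact ⟨Or.inl rfl, Or.inl rfl⟩
            · exact ⟨Or.inr (Or.inl rfl), Or.inr (Or.inr hza.symm)⟩
          have := ncard_le_ncard this ((toFinite _).inter_of_left _)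
          rw [ncard_pair hae.symm] at this; omega
        · intro hzb
          have : ({e, b} : Set α) ⊆ {e, a, b} ∩ {e, c, z} := by
            intro t ht; simp only [mem_insert_iff, mem_singleton_iff] at ht ⊢
            rcases ht with rfl | rfl
            · exact ⟨Or.inl rfl, Or.inl rfl⟩
            · exact ⟨Or.inr (Or.inr rfl), Or.inr (Or.inr hzb.symm)⟩
          have := ncard_le_ncard this ((toFinite _).inter_of_left _)
          rw [ncard_pair hbe.symm] at this; omega
      refine ⟨{S : Set α | S ⊆ Q ∧ S.ncard = 3 ∧ c ∈ S ∧ z ∈ S}, fun S hS => ⟨hS.1, hS.2.1⟩, ?_, ?_, ?_⟩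
      · -- disjoint from `A`: a common member would contain `a, b, c, z`, four distinct points
        rw [disjoint_left]
        intro S hSA hSB
        have hsub : ({a, b, c, z} : Set α) ⊆ S := by
          intro t ht; simp only [mem_insert_iff, mem_singleton_iff] at ht
          rcases ht with rfl | rfl | rfl | rfl
          · exact hSA.2.2.1
          · exact hSA.2.2.2
          · exact hSB.2.2.1
          · exact hSB.2.2.2
        have h4 : ({a, b, c, z} : Set α).ncard = 4 := by
          rw [ncard_insert_of_notMem (by simp [hab, hca.symm, hzab.1.symm]) (toFinite _),
            ncard_eq_three.2 ⟨b, c, z, hcb.symm, hzab.2.symm, hzc.symm, rfl⟩]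
        have := ncard_le_ncard hsub (hQfin.subset hSA.1)
        have hS3 := hSA.2.1
        omega
      · -- nonempty: `{c, z, a}` is a member
        have hmem : ({c, z, a} : Set α) ∈ {S : Set α | S ⊆ Q ∧ S.ncard = 3 ∧ c ∈ S ∧ z ∈ S} := by
          refine ⟨?_, ncard_eq_three.2 ⟨c, z, a, hzc.symm, hca, hzab.1, rfl⟩, by simp, by simp⟩
          intro t ht; simp only [mem_insert_iff, mem_singleton_iff] at ht
          rcases ht with rfl | rfl | rfl; exact hcQ.1 |> fun h => ⟨h, hce⟩; exact hzQ; exact haQ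
        have := ncard_pos (hQfin.finite_subsets.subset (fun S hS => hS.1)) |>.2 ⟨_, hmem⟩
        omega
      · intro C hC hCB
        exact not_fourCircuit_of_triple_subset M hC.1 hC.2.1 (T := {e, c, z}) (by
          intro t ht; simp only [mem_insert_iff, mem_singleton_iff] at ht
          rcases ht with rfl | rfl | rfl
          · exact hC.2.2.1
          · exact hCB.2.2.1.1
          · exact hCB.2.2.2.1) (ncard_eq_three.2 ⟨e, c, z, hce.symm, (fun h => hzQ.2 (mem_singleton_iff.2 h.symm)), hzc.symm, rfl⟩) hrcz
    · -- `{c, x, y} ⊆ Q` is itself a killed 3-subset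
      push Not at hex
      have hxe : x ≠ e := fun h => hex.1 h.symm
      have hye : y ≠ e := fun h => hex.2 h.symm
      have hT : ({c, x, y} : Set α) ⊆ Q := by
        intro t ht; simp only [mem_insert_iff, mem_singleton_iff] at ht
        rcases ht with rfl | rfl | rfl; exact hcQ; exact ⟨hxP, hxe⟩; exact ⟨hyP, hye⟩
      have hT3 : ({c, x, y} : Set α).ncard = 3 := ncard_eq_three.2 ⟨c, x, y, hxc.symm, hyc.symm, hxy, rfl⟩
      refine ⟨{ {c, x, y} }, ?_, ?_, by rw [ncard_singleton], ?_⟩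
      · intro S hS; rw [mem_singleton_iff] at hS; rw [hS]; exact ⟨hT, hT3⟩
      · -- `{c, x, y} ∉ A`: else `{a, b} ⊆ {x, y}` and `{c, a, b}`, `{e, a, b}` would be rank-2 triples sharing `a, b`
        rw [disjoint_left]
        intro S hSA hSB
        rw [mem_singleton_iff] at hSB
        rw [hSB] at hSA
        have haT : a ∈ ({c, x, y} : Set α) := hSA.2.2.1
        have hbT : b ∈ ({c, x, y} : Set α) := hSA.2.2.2
        have hT1 : ({e, a, b} : Set α) ⊆ M.E := by
          intro t ht; simp only [mem_insert_iff, mem_singleton_iff] at ht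
          rcases ht with rfl | rfl | rfl; exact hP he; exact hP haP; exact hP hbP
        have hT2 : ({c, x, y} : Set α) ⊆ M.E := hT.trans (sdiff_subset.trans hP)
        have h3a : ({e, a, b} : Set α).ncard = 3 := ncard_eq_three.2 ⟨e, a, b, hae.symm, hbe.symm, hab, rfl⟩
        have hne : ({e, a, b} : Set α) ≠ {c, x, y} := by
          intro h
          have : e ∈ ({c, x, y} : Set α) := h ▸ (by simp)
          simp only [mem_insert_iff, mem_singleton_iff] at this
          rcases this with h' | h' | h'
          · exact hce h'.symm
          · exact hxe h'.symm
          · exact hye h'.symm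
        have hint := inter_ncard_le_one_of_triples M hfree hT1 hT2 hrab hrcxy h3a hT3 hne
        have : ({a, b} : Set α) ⊆ {e, a, b} ∩ {c, x, y} := by
          intro t ht; simp only [mem_insert_iff, mem_singleton_iff] at ht
          rcases ht with rfl | rfl
          · exact ⟨by simp, haT⟩
          · exact ⟨by simp, hbT⟩
        have := ncard_le_ncard this ((toFinite _).inter_of_left _)
        rw [ncard_pair hab] at this; omega
      · intro C hC hCB
        rw [mem_singleton_iff] at hCB
        exact not_fourCircuit_of_triple_subset M hC.1 hC.2.1 (T := {c, x, y}) (by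
          rw [← hCB]; exact sdiff_subset) hT3 hrcxy
  obtain ⟨B, hB𝒯, hAB, hB1, hnotB⟩ := hkill
  have hsub : 𝒞.ncard ≤ (𝒯 \ (A ∪ B)).ncard := by
    refine ncard_le_ncard_of_injOn (fun C : Set α => C \ {e}) ?_ hinj (h𝒯fin.subset sdiff_subset)
    intro C hC
    refine ⟨hmap C hC, ?_⟩
    simp only [mem_union, not_or]
    exact ⟨hnotA C hC, hnotB C hC⟩
  have hAB𝒯 : A ∪ B ⊆ 𝒯 := union_subset hA𝒯 hB𝒯
  have hABcard : (A ∪ B).ncard = A.ncard + B.ncard :=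
    ncard_union_eq hAB (h𝒯fin.subset hA𝒯) (h𝒯fin.subset hB𝒯)
  rw [ncard_sdiff hAB𝒯 (h𝒯fin.subset hAB𝒯), h𝒯10, hABcard, hA3] at hsub
  omega


end S1

end PercRepro
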